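import Mathlib
import HarnessLib.Audit
import Summits.PneNP.PneNP.Theorems.PstarChordReadHubLocal

/-!
# Fibres of the outside variables: restricted readers, chord-locality on a fibre, the free lunch on a fibre (ROUND-24, O1; memo g23 §25)

FRONTIER range-avoidance ladder, rung F-N3, ROUND 24 (cell `pnp-ideate`, prover-2 memos `g22/O1-PAIRCORE-g22.md` §20–§24, `g23` §25; typed target
`PstarCoreBoundTargets.TerminalPeelable` (p646951); restricted-model proof complexity — nothing here bears on `P` versus `NP`).

Tools for the CLEAN TWO-CHORD THEOREM (`PstarChordReadTwoClean.false_of_two_clean`: two outside-gated slice-generic chords kill a terminal core,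
with NO hypothesis on partners or attachments).  Everything happens on the FIBRE of a point `w`: the set of points agreeing with `w` on
`outside I J₀`, the variables read by no output of the core `J₀`.

* `outside I J₀`, `mem_outside`; `restrictL_snd_avoid` (the monomials of a multiple restriction avoid the restricted variables);
  `mem_restrictL_fst_iff` (a variable lying in no monomial — e.g. an XOR variable — keeps its linear membership under restriction of other
  variables); `mv_of_no_monomial` (its move is its linear indicator).
* CHORD-LOCAL READERS (`PstarChordReadLemma.ChordLocal`): `not_mem_of_chordLocal` (a chord-local reader does not read a monomial-free variable off
  the chord), `xor_mem_iff_of_chordLocal` (it reads the two XOR variables of the chord alike), `indep_of_chordLocal` (if it reads neither, it is a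
  function of the two privates).
* `partners_subset_outside` — the partners of a private of an OUTSIDE-GATED chord (`PstarChordReadOutside.OutsideGated`) are outside, so the direction
  `(mv₁ v, mv₂ v)` of the private is constant on a fibre (`mv_eq_of_fibre`).
* `chordLocal_restrictL_of_fail` — RESTRICTED SLICE LEMMA: if a reader with menu monomials misses a value at every solution of the core on a private
  slice of the outside-gated slice-generic chord `c` INSIDE THE FIBRE of `w`, then the restricted reader
  `restrictL Γ (fibreList (outside I J₀) w)` (`PstarChordReadRestrictVar`, `PstarChordReadNor`) is chord-local at `c`.
* FREE LUNCH ON A FIBRE: `local₂_of_dir10`, `local₁_of_dir01`, `local₁₂_of_dir11` — if the direction of a private of `c` at `w` is `(1,0)` / `(0,1)` /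
  `(1,1)`, then `Γ₂|_w` / `Γ₁|_w` / `(Γ₁ ⊕ Γ₂)|_w` is chord-local at `c` (`PstarChordReadHubLocal.fail*_of_dir*` at the overridden points).

No Assumption A; genericity used: `SliceGeneric` at the one chord.
-/

set_option linter.dupNamespace false -- `Summit.PneNP.PneNP.…`: summit = sub-problem name (D-0017 single-conjunct layout)

open Finset Literature.Computability.Complexity
open scoped symmDiff
open Summit.PneNP.PneNP.Theorems.PstarFibrePolys (bit bit_injective)
open Summit.PneNP.PneNP.Theorems.PstarTyped (Typed)
open Summit.PneNP.PneNP.Theorems.PstarSALevel (varSet bdry BoundaryExpanding SimpleOverlap)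
open Summit.PneNP.PneNP.Theorems.PstarGapPeeling (not_mem_varSet_of_private eval_update_of_not_mem eval_pure)
open Summit.PneNP.PneNP.Theorems.PstarCentreFree (vars_mem_varSet)
open Summit.PneNP.PneNP.Theorems.PstarGapOneAll (gval)
open Summit.PneNP.PneNP.Theorems.PstarGSystemFreeVar (gval_symmDiff)
open Summit.PneNP.PneNP.Theorems.PstarChordRepair (IsChord)
open Summit.PneNP.PneNP.Theorems.PstarCoreBoundTargets (Terminal)
open Summit.PneNP.PneNP.Theorems.PstarGSat (gSat)
open Summit.PneNP.PneNP.Theorems.PstarChordBridgeTools (coef)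
open Summit.PneNP.PneNP.Theorems.PstarChordReadLemma (ChordLocal SliceGeneric chordLocal_of_fail_slice)
open Summit.PneNP.PneNP.Theorems.PstarChordReadGates (sliceGeneric_mono exists_two_slices)
open Summit.PneNP.PneNP.Theorems.PstarChordReadTwoGates (exists_xor_not_mem_of_simpleOverlap)
open Summit.PneNP.PneNP.Theorems.PstarChordReadFlip (mv gval_flip mv_update_of_ne eq_of_pair)
open Summit.PneNP.PneNP.Theorems.PstarChordReadOutside (partners mem_partners_iff IsGate OutsideGated exists_gate_of_slot)
open Summit.PneNP.PneNP.Theorems.PstarChordReadRestrictVar (avoid mem_avoid restrict1 restrictL constL overrideL gval_restrictL restrictL_snd_subset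
  overrideL_eq_self)
open Summit.PneNP.PneNP.Theorems.PstarChordReadNor (fibreList mem_fibreList overrideL_fibreList_of_mem overrideL_fibreList_of_not_mem
  overrideL_fibreList_self solves_overrideL_fibreList mv_congr)
open Summit.PneNP.PneNP.Theorems.PstarChordReadHubLocal (fail₂_of_dir10 fail₁_of_dir01 failSum_of_dir11)

namespace Summit.PneNP.PneNP.Theorems.PstarChordReadFibre

variable {n m : ℕ}

/-! ## Outside variables, fibres, restricted readers -/
section Fibre

variable (I : LocalMap 4 n m)

/-- The **OUTSIDE** variables of the core `J₀`: those read by no output of `J₀`. -/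
def outside (J₀ : Finset (Fin m)) : Finset (Fin n) := univ.filter fun v => ∀ j ∈ J₀, v ∉ varSet I j

/-- Membership in `outside`. -/
theorem mem_outside {J₀ : Finset (Fin m)} {v : Fin n} : v ∈ outside I J₀ ↔ ∀ j ∈ J₀, v ∉ varSet I j := by
  unfold outside
  rw [mem_filter]
  exact ⟨fun h => h.2, fun h => ⟨mem_univ _, h⟩⟩

/-- A variable of a core output is not outside. -/
theorem not_mem_outside_of_mem {J₀ : Finset (Fin m)} {j : Fin m} (hj : j ∈ J₀) {v : Fin n} (hv : v ∈ varSet I j) : v ∉ outside I J₀ :=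
  fun h => (mem_outside I).1 h j hj hv

/-- The monomials of a multiple restriction avoid every restricted variable. -/
theorem restrictL_snd_avoid (C : Finset (Fin n)) (G : Finset (Fin m)) :
    ∀ (L : List (Fin n × Bool)) (g : Fin m), g ∈ (restrictL I C G L).2 → ∀ p ∈ L, I.vars g 2 ≠ p.1 ∧ I.vars g 3 ≠ p.1
  | [], _, _, p, hp => absurd hp List.not_mem_nil
  | q :: L, g, hg, p, hp => by
    have hg' : g ∈ avoid I (restrictL I C G L).2 q.1 := by
      have e : (restrictL I C G (q :: L)).2 = (restrict1 I (restrictL I C G L).1 (restrictL I C G L).2 q.1 q.2).2 := rfl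
      rw [e] at hg
      revert hg; cases q.2 <;> exact id
    obtain ⟨hgL, h2, h3⟩ := (mem_avoid I).1 hg'
    rcases List.mem_cons.1 hp with rfl | hp
    · exact ⟨h2, h3⟩
    · exact restrictL_snd_avoid C G L g hgL p hp

/-- **A variable in no monomial keeps its linear membership under restriction** of other variables (XOR variables are of this kind). -/
theorem mem_restrictL_fst_iff (hI : I.IsPure xorAndPred) (C : Finset (Fin n)) (G : Finset (Fin m)) {u : Fin n}
    (hu : ∀ g ∈ G, I.vars g 2 ≠ u ∧ I.vars g 3 ≠ u) :
    ∀ L : List (Fin n × Bool), (∀ p ∈ L, p.1 ≠ u) → (u ∈ (restrictL I C G L).1 ↔ u ∈ C)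
  | [], _ => Iff.rfl
  | q :: L, hL => by
    classical
    have ih := mem_restrictL_fst_iff hI C G hu L fun p hp => hL p (List.mem_cons_of_mem _ hp)
    have hqu : q.1 ≠ u := hL q List.mem_cons_self
    have hnp : u ∉ partners I (restrictL I C G L).2 q.1 := by
      intro h
      obtain ⟨g, hg, hp⟩ := (mem_partners_iff I hI).1 h
      have hgG := restrictL_snd_subset I C G L hg
      rcases hp with ⟨-, h3⟩ | ⟨h2, -⟩
      · exact (hu g hgG).2 h3
      · exact (hu g hgG).1 h2
    have e : (restrictL I C G (q :: L)).1 = (restrict1 I (restrictL I C G L).1 (restrictL I C G L).2 q.1 q.2).1 := rfl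
    rw [e, ← ih]
    rcases hκ : q.2 with _ | _
    · show u ∈ ((restrictL I C G L).1).erase q.1 ↔ _
      rw [mem_erase]
      exact ⟨fun h => h.2, fun h => ⟨hqu.symm, h⟩⟩
    · show u ∈ ((restrictL I C G L).1).erase q.1 ∆ partners I (restrictL I C G L).2 q.1 ↔ _
      rw [mem_symmDiff, mem_erase]
      constructor
      · rintro (⟨⟨-, h⟩, -⟩ | ⟨h, -⟩)
        · exact h
        · exact absurd h hnp
      · exact fun h => Or.inl ⟨⟨hqu.symm, h⟩, hnp⟩

/-- The move of a variable in no monomial is its linear indicator. -/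
theorem mv_of_no_monomial (C : Finset (Fin n)) (G : Finset (Fin m)) {u : Fin n} (hu : ∀ g ∈ G, I.vars g 2 ≠ u ∧ I.vars g 3 ≠ u)
    (x : Fin n → Bool) : mv I C G u x = decide (u ∈ C) := by
  unfold PstarChordReadFlip.mv PstarChordBridgeTools.coef
  rw [sum_eq_zero (fun g hg => by rw [if_neg (hu g hg).1, if_neg (hu g hg).2, add_zero]), add_zero]
  by_cases h : u ∈ C
  · rw [if_pos h, decide_eq_true h]; decide
  · rw [if_neg h, decide_eq_false h]; decide

end Fibre

/-! ## Chord-local readers: blindness to foreign XOR variables -/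
section Local

variable {I : LocalMap 4 n m} {c : Fin m} {C : Finset (Fin n)} {G : Finset (Fin m)}

/-- **A chord-local reader does not read a monomial-free variable off the chord.** -/
theorem not_mem_of_chordLocal (hI : I.IsPure xorAndPred) (hloc : ChordLocal I c C G) {u : Fin n} (h0 : u ≠ I.vars c 0) (h1 : u ≠ I.vars c 1)
    (h2 : u ≠ I.vars c 2) (h3 : u ≠ I.vars c 3) (hu : ∀ g ∈ G, I.vars g 2 ≠ u ∧ I.vars g 3 ≠ u) : u ∉ C := by
  obtain ⟨φ, hφ⟩ := hloc
  set x : Fin n → Bool := fun _ => false with hx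
  have e := gval_flip I C G hI x u
  rw [hφ, hφ, Function.update_of_ne h0.symm, Function.update_of_ne h1.symm, Function.update_of_ne h2.symm, Function.update_of_ne h3.symm,
    mv_of_no_monomial I C G hu] at e
  intro huC
  rw [decide_eq_true huC] at e
  revert e; cases φ (xor (x (I.vars c 0)) (x (I.vars c 1))) (x (I.vars c 2)) (x (I.vars c 3)) <;> decide

/-- **A chord-local reader reads the two XOR variables of its chord alike.** -/
theorem xor_mem_iff_of_chordLocal (hI : I.IsPure xorAndPred) (hT : Typed I) (hloc : ChordLocal I c C G) : (I.vars c 0 ∈ C ↔ I.vars c 1 ∈ C) := by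
  obtain ⟨φ, hφ⟩ := hloc
  have hua : ∀ g ∈ G, I.vars g 2 ≠ I.vars c 0 ∧ I.vars g 3 ≠ I.vars c 0 :=
    fun g _ => ⟨(hT c g 0 2 (by decide) (by decide)).symm, (hT c g 0 3 (by decide) (by decide)).symm⟩
  have hub : ∀ g ∈ G, I.vars g 2 ≠ I.vars c 1 ∧ I.vars g 3 ≠ I.vars c 1 :=
    fun g _ => ⟨(hT c g 1 2 (by decide) (by decide)).symm, (hT c g 1 3 (by decide) (by decide)).symm⟩
  have h01 : I.vars c 0 ≠ I.vars c 1 := fun e => absurd (hI.2 c e) (by decide)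
  have h02 : I.vars c 0 ≠ I.vars c 2 := fun e => absurd (hI.2 c e) (by decide)
  have h03 : I.vars c 0 ≠ I.vars c 3 := fun e => absurd (hI.2 c e) (by decide)
  have h12 : I.vars c 1 ≠ I.vars c 2 := fun e => absurd (hI.2 c e) (by decide)
  have h13 : I.vars c 1 ≠ I.vars c 3 := fun e => absurd (hI.2 c e) (by decide)
  set x : Fin n → Bool := fun _ => false with hx
  have ea := gval_flip I C G hI x (I.vars c 0)
  have eb := gval_flip I C G hI x (I.vars c 1)
  rw [hφ, hφ, Function.update_self, Function.update_of_ne h01.symm, Function.update_of_ne h02.symm, Function.update_of_ne h03.symm,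
    mv_of_no_monomial I C G hua] at ea
  rw [hφ, hφ, Function.update_self, Function.update_of_ne h01, Function.update_of_ne h12.symm, Function.update_of_ne h13.symm,
    mv_of_no_monomial I C G hub] at eb
  have e : decide (I.vars c 0 ∈ C) = decide (I.vars c 1 ∈ C) := by
    revert ea eb
    cases φ (xor (x (I.vars c 0)) (x (I.vars c 1))) (x (I.vars c 2)) (x (I.vars c 3)) <;> cases decide (I.vars c 0 ∈ C) <;>
      cases decide (I.vars c 1 ∈ C) <;> simp [hx]
  constructor
  · intro h; by_contra h'; rw [decide_eq_true h, decide_eq_false h'] at e; exact absurd e (by decide)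
  · intro h; by_contra h'; rw [decide_eq_true h, decide_eq_false h'] at e; exact absurd e (by decide)

/-- **A chord-local reader not reading the XOR pair is a function of the two privates.** -/
theorem indep_of_chordLocal (hI : I.IsPure xorAndPred) (hT : Typed I) (hloc : ChordLocal I c C G) (ha : I.vars c 0 ∉ C) :
    ∃ ψ : Bool → Bool → Bool, ∀ x : Fin n → Bool, gval I C G x = ψ (x (I.vars c 2)) (x (I.vars c 3)) := by
  obtain ⟨φ, hφ⟩ := hloc
  have hua : ∀ g ∈ G, I.vars g 2 ≠ I.vars c 0 ∧ I.vars g 3 ≠ I.vars c 0 :=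
    fun g _ => ⟨(hT c g 0 2 (by decide) (by decide)).symm, (hT c g 0 3 (by decide) (by decide)).symm⟩
  have h01 : I.vars c 0 ≠ I.vars c 1 := fun e => absurd (hI.2 c e) (by decide)
  have h02 : I.vars c 0 ≠ I.vars c 2 := fun e => absurd (hI.2 c e) (by decide)
  have h03 : I.vars c 0 ≠ I.vars c 3 := fun e => absurd (hI.2 c e) (by decide)
  refine ⟨fun π κ => φ false π κ, fun x => ?_⟩
  by_cases hs : xor (x (I.vars c 0)) (x (I.vars c 1)) = false
  · rw [hφ x, hs]
  · have e := gval_flip I C G hI x (I.vars c 0)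
    rw [mv_of_no_monomial I C G hua, decide_eq_false ha, Bool.xor_false, hφ, Function.update_self, Function.update_of_ne h01.symm,
      Function.update_of_ne h02.symm, Function.update_of_ne h03.symm] at e
    rw [← e]
    congr 1
    revert hs; cases x (I.vars c 0) <;> cases x (I.vars c 1) <;> decide

end Local

/-! ## The restricted slice lemma and the free lunch on a fibre -/
section Slice

variable {I : LocalMap 4 n m} {r : ℕ} {y : Fin m → Bool} {J₀ : Finset (Fin m)} {w₁ w₂ : Finset (Fin n) × Finset (Fin m) × Bool}
  {c : Fin m} {𝒢 : Finset (Fin m)}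

/-- The partners of a private of an outside-gated chord are outside. -/
theorem partners_subset_outside (hI : I.IsPure xorAndPred) (hO : OutsideGated I J₀ 𝒢 c) (hc : c ∈ J₀) {G : Finset (Fin m)} (hG : G ⊆ 𝒢)
    {v : Fin n} (hv : v = I.vars c 2 ∨ v = I.vars c 3) : ∀ u ∈ partners I G v, u ∈ outside I J₀ := by
  intro u hu
  obtain ⟨g, hg, hp⟩ := (mem_partners_iff I hI).1 hu
  have hgv : I.vars g 2 = v ∨ I.vars g 3 = v := by
    rcases hp with ⟨h2, -⟩ | ⟨-, h3⟩
    exacts [Or.inl h2, Or.inr h3]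
  obtain ⟨z, hGate⟩ := exists_gate_of_slot hO hc (hG hg) hv hgv
  have hvz : v ≠ z := hGate.ne hc
  have huz : u = z := by
    rcases hp with ⟨h2, h3⟩ | ⟨h2, h3⟩ <;> rcases hGate.2.1 with ⟨g2, g3⟩ | ⟨g2, g3⟩
    · exact h3.symm.trans g3
    · exact absurd (h2.symm.trans g2) hvz
    · exact absurd (h3.symm.trans g3) hvz
    · exact h2.symm.trans g2
  rw [huz]
  exact (mem_outside I).2 hGate.2.2

/-- **RESTRICTED SLICE LEMMA.**  `c` an outside-gated slice-generic chord for the menu `𝒢`; a reader `(C, G)`, `G ⊆ 𝒢`, missing `β` at every solution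
of the core on the private slice `(π, κ)` of `c` inside the fibre of `w`.  Then `Γ|_w` is chord-local at `c`. -/
theorem chordLocal_restrictL_of_fail (hI : I.IsPure xorAndPred) (hS : SimpleOverlap I) (hc : c ∈ J₀) (hch : IsChord I J₀ c)
    (hO : OutsideGated I J₀ 𝒢 c) (hgen : SliceGeneric I y J₀ c 𝒢) {C : Finset (Fin n)} {G : Finset (Fin m)} (hG : G ⊆ 𝒢) (w : Fin n → Bool)
    (π κ β : Bool)
    (hfail : ∀ x : Fin n → Bool, (∀ j ∈ J₀, I.eval x j = y j) → x (I.vars c 2) = π → x (I.vars c 3) = κ →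
      (∀ z ∈ outside I J₀, x z = w z) → gval I C G x ≠ β) :
    ChordLocal I c (restrictL I C G (fibreList (outside I J₀) w)).1 (restrictL I C G (fibreList (outside I J₀) w)).2 := by
  classical
  set Z := outside I J₀ with hZ
  set L := fibreList Z w with hL
  set R := restrictL I C G L with hR
  have hZout : ∀ z ∈ Z, ∀ j ∈ J₀, z ∉ varSet I j := fun z hz => (mem_outside I).1 hz
  have hR₂ : R.2 ⊆ G := restrictL_snd_subset I C G L
  have hp : I.vars c 2 ∉ Z := not_mem_outside_of_mem I hc (vars_mem_varSet I c 2)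
  have hq : I.vars c 3 ∉ Z := not_mem_outside_of_mem I hc (vars_mem_varSet I c 3)
  -- the restricted monomials avoid the AND pair of `c`
  have avoids : ∀ g ∈ R.2, ∀ {v : Fin n}, (v = I.vars c 2 ∨ v = I.vars c 3) → I.vars g 2 ≠ v ∧ I.vars g 3 ≠ v := by
    intro g hg v hv
    by_contra hne
    have hgv : I.vars g 2 = v ∨ I.vars g 3 = v := by
      by_contra h'; push Not at h'; exact hne h'
    obtain ⟨z, hGate⟩ := exists_gate_of_slot hO hc (hG (hR₂ hg)) hv hgv
    have hzZ : z ∈ Z := (mem_outside I).2 hGate.2.2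
    have hav := restrictL_snd_avoid I C G L g hg (z, w z) (mem_fibreList.2 ⟨hzZ, rfl⟩)
    rcases hGate.2.1 with ⟨-, h3⟩ | ⟨h2, -⟩
    · exact hav.2 h3
    · exact hav.1 h2
  have hmono : ∀ g ∈ R.2, (I.vars g 2 ≠ I.vars c 2 ∧ I.vars g 3 ≠ I.vars c 2) ∧ (I.vars g 2 ≠ I.vars c 3 ∧ I.vars g 3 ≠ I.vars c 3) :=
    fun g hg => ⟨avoids g hg (Or.inl rfl), avoids g hg (Or.inr rfl)⟩
  refine chordLocal_of_fail_slice hI hc hch (sliceGeneric_mono (hR₂.trans hG) hgen) hmono (Subset.refl _) π κ (xor β (constL I C G L))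
    fun x hx hxp hxq h => ?_
  rw [hR, gval_restrictL I hI hS] at h
  have hs := solves_overrideL_fibreList I hZout w hx
  have hne := hfail (overrideL x L) hs (by rw [hL, overrideL_fibreList_of_not_mem w x hp]; exact hxp)
    (by rw [hL, overrideL_fibreList_of_not_mem w x hq]; exact hxq) (fun z hz => by rw [hL, overrideL_fibreList_of_mem w x hz])
  revert h hne
  cases gval I C G (overrideL x L) <;> cases β <;> cases constL I C G L <;> decide

variable {v v' : Fin n}

/-- On the fibre of `w`, the direction of a private of an outside-gated chord is constant. -/
theorem mv_eq_of_fibre (hI : I.IsPure xorAndPred) (hS : SimpleOverlap I) (hO : OutsideGated I J₀ 𝒢 c) (hc : c ∈ J₀) {C : Finset (Fin n)}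
    {G : Finset (Fin m)} (hG : G ⊆ 𝒢) (hv : v = I.vars c 2 ∨ v = I.vars c 3) {x w : Fin n → Bool} (hx : ∀ z ∈ outside I J₀, x z = w z) :
    mv I C G v x = mv I C G v w :=
  mv_congr I hI hS C G v fun u hu => hx u (partners_subset_outside hI hO hc hG hv u hu)

/-- **Direction `(1,0)` at `w` ⟹ `Γ₂|_w` is chord-local at `c`.** -/
theorem local₂_of_dir10 (hI : I.IsPure xorAndPred) (hS : SimpleOverlap I) (ht : Terminal I r y J₀ w₁ w₂) (hc : c ∈ J₀) (hch : IsChord I J₀ c)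
    (hO : OutsideGated I J₀ (w₁.2.1 ∪ w₂.2.1) c) (hgen : SliceGeneric I y J₀ c (w₁.2.1 ∪ w₂.2.1))
    (hvv : (I.vars c 2 = v ∧ I.vars c 3 = v') ∨ (I.vars c 2 = v' ∧ I.vars c 3 = v)) (w : Fin n → Bool)
    (h₁ : mv I w₁.1 w₁.2.1 v w = true) (h₂ : mv I w₂.1 w₂.2.1 v w = false) :
    ChordLocal I c (restrictL I w₂.1 w₂.2.1 (fibreList (outside I J₀) w)).1 (restrictL I w₂.1 w₂.2.1 (fibreList (outside I J₀) w)).2 := by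
  have hv : v = I.vars c 2 ∨ v = I.vars c 3 := by
    rcases hvv with ⟨h, -⟩ | ⟨-, h⟩
    exacts [Or.inl h.symm, Or.inr h.symm]
  refine chordLocal_restrictL_of_fail hI hS hc hch hO hgen subset_union_right w false false w₂.2.2 fun x hx hxp hxq hz => ?_
  have h0 : x v' = false := by
    rcases hvv with ⟨-, h⟩ | ⟨h, -⟩
    · rw [← h]; exact hxq
    · rw [← h]; exact hxp
  exact fail₂_of_dir10 hI ht hc hch hvv hx h0 (by rw [mv_eq_of_fibre hI hS hO hc subset_union_left hv hz]; exact h₁)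
    (by rw [mv_eq_of_fibre hI hS hO hc subset_union_right hv hz]; exact h₂)

/-- **Direction `(0,1)` at `w` ⟹ `Γ₁|_w` is chord-local at `c`.** -/
theorem local₁_of_dir01 (hI : I.IsPure xorAndPred) (hS : SimpleOverlap I) (ht : Terminal I r y J₀ w₁ w₂) (hc : c ∈ J₀) (hch : IsChord I J₀ c)
    (hO : OutsideGated I J₀ (w₁.2.1 ∪ w₂.2.1) c) (hgen : SliceGeneric I y J₀ c (w₁.2.1 ∪ w₂.2.1))
    (hvv : (I.vars c 2 = v ∧ I.vars c 3 = v') ∨ (I.vars c 2 = v' ∧ I.vars c 3 = v)) (w : Fin n → Bool)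
    (h₁ : mv I w₁.1 w₁.2.1 v w = false) (h₂ : mv I w₂.1 w₂.2.1 v w = true) :
    ChordLocal I c (restrictL I w₁.1 w₁.2.1 (fibreList (outside I J₀) w)).1 (restrictL I w₁.1 w₁.2.1 (fibreList (outside I J₀) w)).2 := by
  have hv : v = I.vars c 2 ∨ v = I.vars c 3 := by
    rcases hvv with ⟨h, -⟩ | ⟨-, h⟩
    exacts [Or.inl h.symm, Or.inr h.symm]
  refine chordLocal_restrictL_of_fail hI hS hc hch hO hgen subset_union_left w false false w₁.2.2 fun x hx hxp hxq hz => ?_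
  have h0 : x v' = false := by
    rcases hvv with ⟨-, h⟩ | ⟨h, -⟩
    · rw [← h]; exact hxq
    · rw [← h]; exact hxp
  exact fail₁_of_dir01 hI ht hc hch hvv hx h0 (by rw [mv_eq_of_fibre hI hS hO hc subset_union_left hv hz]; exact h₁)
    (by rw [mv_eq_of_fibre hI hS hO hc subset_union_right hv hz]; exact h₂)

/-- The symmetric-difference menu lies in the union menu. -/
theorem symmDiff_subset_union' (G₁ G₂ : Finset (Fin m)) : G₁ ∆ G₂ ⊆ G₁ ∪ G₂ := by
  intro g hg
  rw [mem_symmDiff] at hg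
  rcases hg with ⟨h, -⟩ | ⟨h, -⟩
  exacts [mem_union_left _ h, mem_union_right _ h]

/-- **Direction `(1,1)` at `w` ⟹ `(Γ₁ ⊕ Γ₂)|_w` is chord-local at `c`.** -/
theorem local₁₂_of_dir11 (hI : I.IsPure xorAndPred) (hS : SimpleOverlap I) (ht : Terminal I r y J₀ w₁ w₂) (hc : c ∈ J₀) (hch : IsChord I J₀ c)
    (hO : OutsideGated I J₀ (w₁.2.1 ∪ w₂.2.1) c) (hgen : SliceGeneric I y J₀ c (w₁.2.1 ∪ w₂.2.1))
    (hvv : (I.vars c 2 = v ∧ I.vars c 3 = v') ∨ (I.vars c 2 = v' ∧ I.vars c 3 = v)) (w : Fin n → Bool)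
    (h₁ : mv I w₁.1 w₁.2.1 v w = true) (h₂ : mv I w₂.1 w₂.2.1 v w = true) :
    ChordLocal I c (restrictL I (w₁.1 ∆ w₂.1) (w₁.2.1 ∆ w₂.2.1) (fibreList (outside I J₀) w)).1
      (restrictL I (w₁.1 ∆ w₂.1) (w₁.2.1 ∆ w₂.2.1) (fibreList (outside I J₀) w)).2 := by
  have hv : v = I.vars c 2 ∨ v = I.vars c 3 := by
    rcases hvv with ⟨h, -⟩ | ⟨-, h⟩
    exacts [Or.inl h.symm, Or.inr h.symm]
  refine chordLocal_restrictL_of_fail hI hS hc hch hO hgen (symmDiff_subset_union' _ _) w false false (xor w₁.2.2 w₂.2.2)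
    fun x hx hxp hxq hz => ?_
  have h0 : x v' = false := by
    rcases hvv with ⟨-, h⟩ | ⟨h, -⟩
    · rw [← h]; exact hxq
    · rw [← h]; exact hxp
  exact failSum_of_dir11 hI ht hc hch hvv hx h0 (by rw [mv_eq_of_fibre hI hS hO hc subset_union_left hv hz]; exact h₁)
    (by rw [mv_eq_of_fibre hI hS hO hc subset_union_right hv hz]; exact h₂)

end Slice

end Summit.PneNP.PneNP.Theorems.PstarChordReadFibre
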